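/-
Copyright (c) 2026 the pub-hodgecm-mathlib formalisation cell (harness21).  Prover seat hodgecm-mathlib-K2E3-p03 (g10) on the S4 valve (dealer K2E2-plan (g8), S4-R38 (C),
CARD B = road (J̃♭) FILE (TJ2), part 1 of 2): THE THIRD-SLOT GENERALISATION OF ★ C5 `Literature.NumberTheory.Weil1982.CayleyTwistedSandwich` §3–§4.
Crux H413 `stmt-HodgeConjecture-24833`, lane `--supports … --as helper` (count-neutral).  THEOREMS ONLY (no `def`, no `instance`, no notation, no named-fact hypothesis, no `sorry`).
-/
import Literature.NumberTheory.Weil1982.CayleyTwistedSandwich   -- ★ C5: `conj_cayley`, `valBound_conj`, `valBound_cayleySandwich_incr_both` (+ ★ C2 `cayley_mul_cayley_eq_cayley`, `valBound_cayleySandwich`, `isUnit_det_one_{sub,add_mul}_of_valBound`)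
import HarnessLib

/-!
# R90-TF · S4 (Ch. 13.1–2) · road (J̃♭) «TWISTED TUBE JACOBIAN», FILE (TJ2) part 1: THE CAYLEY TUBE WITH AN ARBITRARY THIRD SLOT

★ C5 treats the plain tube `(X, Y) ↦ T⁻¹·c(X)·T·c(Y)·c(X)⁻¹ = T⁻¹·c(X)·T·c(Y)·c(−X)` in the Cayley chart `c = cayley`: third slot `−X`, linear part `T⁻¹X₁T − X₁ + Y₁`.
For the ε-TWISTED tube `(x, b) ↦ x·b·ε(x)⁻¹` of the twisted Weyl integration formula [Rogawski1990, §12.5 p. 186] the last factor is `ε(c(X))⁻¹ = c(τ X)` (★ (TJ1) p864452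
`tau_cayley_inv`: `ε(c X) = c(−τ X)`), so the chart-level tube is `T⁻¹·c(X)·T·c(Y)·c(E X)` with an ADDITIVE third-slot map `E` (= `τ`, the `σ`-semilinear involution
`X ↦ J⁻¹ (X.map σ)ᵀ J`) in place of `−id`, and the linear part becomes `T⁻¹X₁T + E X₁ + Y₁` (census `R90/R90-C131-p04/g2/CENSUS-Jtilde.md` §2–§3).
In ★ C5's proofs the third slot enters ONLY through its entrywise bound and its additivity, so the generalisation is formal; this file records it once, for (TJ2) part 2
`Theorems/R90S4TwistedTubeCore.lean` and for the windows file (TJ4):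
* §1 `cayley_twisted_triple_slot` — `T⁻¹·c(X)·T·c(Y)·c(X′) = c(S(T⁻¹XT, S(Y, X′)))` for ANY third slot `X′ ≤ ρ` (`S(W, Z) = (1 − W)⁻¹(W + Z)(1 + WZ)⁻¹(1 − W)`, ★ C2);
  `valBound_twistedSandwich_slot` (the tube stays in the box); `twistedSandwich_slot_zero` (`= 0` at the origin for an additive `E`).
* §2 **`valBound_twisted_incr_of_sandwich_slot`** — the filtered Newton estimate with linear part `T⁻¹X₁T + E X₁ + Y₁` for any box-stable binary operation with joint
  increments gaining `ρ` and any ADDITIVE `E : M_m(F) →+ M_m(F)` with `E X ≤ ρ`, `E X₁ ≤ γ`; `valBound_twistedSandwich_incr_slot` = the Cayley-sandwich instance.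
★ C5's own statements are the case `E = −id` (`X′ = −X`).  [Serre1992LALG, Part II Ch. IV §8], [PlatonovRapinchuk1994, §3.3], [Rogawski1990, §12.5], [Labesse1999, §III.1].
HONEST LABEL: HC_CM is proved only modulo the 7 printed citations (2 remaining named inputs: hLiu418 = `stmt-HodgeConjecture-24832`, h413 = `stmt-HodgeConjecture-24833`)
until rung 0 closes; pure algebra toward the OPEN (J̃♭) input of (B1); pays no socket.

## References
* [Serre1992LALG] J.-P. Serre, *Lie Algebras and Lie Groups*, LNM 1500 (1992), Part II Ch. IV §8 (standard groups: group law and conjugation are `linear + O(2)`).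
* [PlatonovRapinchuk1994] V. Platonov, A. Rapinchuk, *Algebraic Groups and Number Theory* (1994), §3.3 (congruence subgroups via the Cayley map).
* [Rogawski1990] J. Rogawski, *Automorphic Representations of Unitary Groups in Three Variables*, Ann. of Math. Stud. 123 (1990), §12.5 p. 186.
* [Labesse1999] J.-P. Labesse, *Cohomologie, stabilisation et changement de base*, Astérisque 257 (1999), §III.1 (twisted Jacobian).
-/

set_option autoImplicit false
-- the mandated namespace repeats the single-problem summit's segment (`HodgeConjecture.HodgeConjecture`)
set_option linter.dupNamespace false

open Matrix ValuativeRel Literature.NumberTheory.Automorphic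
open Literature.NumberTheory.Weil1982.UnitaryFinTopForm
open scoped Matrix

namespace Summit.HodgeConjecture.HodgeConjecture.R90.S4

variable {F : Type*} [Field F] [ValuativeRel F] {m : Type*} [Fintype m] [DecidableEq m]

/-! ## §1 The tube in the chart with an arbitrary third slot -/

/-- **THE TUBE IN THE CHART, THIRD SLOT FREE**: `T⁻¹·c(X)·T·c(Y)·c(X′) = c(Θ)`, `Θ = S(T⁻¹XT, S(Y, X′))`, for `X, Y, X′ ≤ ρ < 1` and `T, T⁻¹` integral
(★ C5 `cayley_twisted_triple` is `X′ = −X`). [cite: Serre1992LALG, Part II Ch. IV §8] [cite: PlatonovRapinchuk1994, §3.3] -/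
theorem cayley_twisted_triple_slot {ρ : ValueGroupWithZero F} {T Tinv X Y X' : Matrix m m F} (hT : T * Tinv = 1) (hT' : Tinv * T = 1)
    (hT1 : ValBound 1 T) (hTinv1 : ValBound 1 Tinv) (hX : ValBound ρ X) (hY : ValBound ρ Y) (hX' : ValBound ρ X') (hρ : ρ < 1) :
    Tinv * cayley X * T * cayley Y * cayley X'
      = cayley ((1 - Tinv * X * T)⁻¹ * (Tinv * X * T + ((1 - Y)⁻¹ * (Y + X') * (1 + Y * X')⁻¹ * (1 - Y)))
          * (1 + (Tinv * X * T) * ((1 - Y)⁻¹ * (Y + X') * (1 + Y * X')⁻¹ * (1 - Y)))⁻¹ * (1 - Tinv * X * T)) := by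
  have hXc := valBound_conj hT1 hTinv1 hX
  obtain ⟨hXu, -, -⟩ := isUnit_det_one_sub_of_valBound hX hρ
  obtain ⟨hXcu, -, -⟩ := isUnit_det_one_sub_of_valBound hXc hρ
  obtain ⟨hYu, -, -⟩ := isUnit_det_one_sub_of_valBound hY hρ
  obtain ⟨hX'u, -, -⟩ := isUnit_det_one_sub_of_valBound hX' hρ
  obtain ⟨hBu, -, -⟩ := isUnit_det_one_add_mul_of_valBound hY hX' hρ hρ.le
  have hZ : ValBound ρ ((1 - Y)⁻¹ * (Y + X') * (1 + Y * X')⁻¹ * (1 - Y)) := by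
    simpa using valBound_cayleySandwich hY hX' hρ hρ
  obtain ⟨hZu, -, -⟩ := isUnit_det_one_sub_of_valBound hZ hρ
  obtain ⟨hB'u, -, -⟩ := isUnit_det_one_add_mul_of_valBound hXc hZ hρ hρ.le
  rw [conj_cayley hT hT' hXu, Matrix.mul_assoc, cayley_mul_cayley_eq_cayley hYu hX'u hBu, cayley_mul_cayley_eq_cayley hXcu hZu hB'u]

/-- The tube map with third slot `X′` stays in the box: `Θ ≤ ρ`. [cite: Serre1992LALG, Part II Ch. IV §8] -/
theorem valBound_twistedSandwich_slot {ρ : ValueGroupWithZero F} {T Tinv X Y X' : Matrix m m F}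
    (hT1 : ValBound 1 T) (hTinv1 : ValBound 1 Tinv) (hX : ValBound ρ X) (hY : ValBound ρ Y) (hX' : ValBound ρ X') (hρ : ρ < 1) :
    ValBound ρ ((1 - Tinv * X * T)⁻¹ * (Tinv * X * T + ((1 - Y)⁻¹ * (Y + X') * (1 + Y * X')⁻¹ * (1 - Y)))
          * (1 + (Tinv * X * T) * ((1 - Y)⁻¹ * (Y + X') * (1 + Y * X')⁻¹ * (1 - Y)))⁻¹ * (1 - Tinv * X * T)) := by
  have hXc := valBound_conj hT1 hTinv1 hX
  have hZ : ValBound ρ ((1 - Y)⁻¹ * (Y + X') * (1 + Y * X')⁻¹ * (1 - Y)) := by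
    simpa using valBound_cayleySandwich hY hX' hρ hρ
  simpa using valBound_cayleySandwich hXc hZ hρ hρ

omit [ValuativeRel F] in
/-- The tube map with an ADDITIVE third slot `E` vanishes at the origin (`E 0 = 0`). [cite: Serre1992LALG, Part II Ch. IV §8] -/
theorem twistedSandwich_slot_zero (E : Matrix m m F →+ Matrix m m F) (T Tinv : Matrix m m F) :
    (1 - Tinv * (0 : Matrix m m F) * T)⁻¹ * (Tinv * 0 * T + ((1 - (0 : Matrix m m F))⁻¹ * (0 + E 0) * (1 + 0 * E (0 : Matrix m m F))⁻¹ * (1 - 0)))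
      * (1 + (Tinv * 0 * T) * ((1 - (0 : Matrix m m F))⁻¹ * (0 + E 0) * (1 + 0 * E (0 : Matrix m m F))⁻¹ * (1 - 0)))⁻¹ * (1 - Tinv * 0 * T) = 0 := by
  simp [map_zero]

/-! ## §2 The filtered Newton estimate with linear part `T⁻¹X₁T + E X₁ + Y₁` -/

omit [DecidableEq m] in
/-- **THE FILTERED NEWTON ESTIMATE FOR A TWISTED COMPOSITE WITH AN ADDITIVE THIRD SLOT** (★ C5 `valBound_twisted_incr_of_sandwich` is `E = −id`): for ANY binary
operation `S` on matrices which stays in the box and whose joint increments gain the factor `ρ`, and any additive `E`, the tube map `Θ(X, Y) := S(T⁻¹XT, S(Y, E X))` satisfies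
`Θ(X + X₁, Y + Y₁) − Θ(X, Y) − (T⁻¹X₁T + E X₁ + Y₁) ≤ ργ` for `T, T⁻¹` integral, `X, Y, E X ≤ ρ < 1`, `X₁, Y₁, E X₁ ≤ γ ≤ ρ`.
[cite: Serre1992LALG, Part II Ch. IV §8] [cite: Labesse1999, §III.1] -/
theorem valBound_twisted_incr_of_sandwich_slot (S : Matrix m m F → Matrix m m F → Matrix m m F) {ρ γ : ValueGroupWithZero F} (hρ : ρ < 1) (hγ : γ ≤ ρ)
    (hbox : ∀ {W X : Matrix m m F}, ValBound ρ W → ValBound ρ X → ValBound ρ (S W X))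
    (hincr : ∀ {δ ε : ValueGroupWithZero F} {W X D D' : Matrix m m F}, ValBound ρ W → ValBound ρ X → ValBound δ D → ValBound ε D' →
      δ ≤ ρ → ε ≤ ρ → ValBound (ρ * max δ ε) (S (W + D) (X + D') - S W X - D - D'))
    (E : Matrix m m F →+ Matrix m m F) {T Tinv X Y X₁ Y₁ : Matrix m m F} (hT1 : ValBound 1 T) (hTinv1 : ValBound 1 Tinv)
    (hX : ValBound ρ X) (hY : ValBound ρ Y) (hX₁ : ValBound γ X₁) (hY₁ : ValBound γ Y₁) (hEX : ValBound ρ (E X)) (hEX₁ : ValBound γ (E X₁)) :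
    ValBound (ρ * γ) (S (Tinv * (X + X₁) * T) (S (Y + Y₁) (E (X + X₁))) - S (Tinv * X * T) (S Y (E X)) - (Tinv * X₁ * T + E X₁ + Y₁)) := by
  have hW : ValBound ρ (Tinv * X * T) := valBound_conj hT1 hTinv1 hX
  have hD : ValBound γ (Tinv * X₁ * T) := valBound_conj hT1 hTinv1 hX₁
  -- inner increment: `S (Y + Y₁) (E X + E X₁) − S Y (E X)` is `Y₁ + E X₁` up to `ργ`, hence `≤ γ`
  have hinner : ValBound (ρ * γ) (S (Y + Y₁) (E X + E X₁) - S Y (E X) - Y₁ - E X₁) := by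
    simpa only [max_self] using hincr hY hEX hY₁ hEX₁ hγ hγ
  have hZ : ValBound ρ (S Y (E X)) := hbox hY hEX
  have hE' : ValBound γ (S (Y + Y₁) (E X + E X₁) - S Y (E X)) := by
    have e : S (Y + Y₁) (E X + E X₁) - S Y (E X) = (S (Y + Y₁) (E X + E X₁) - S Y (E X) - Y₁ - E X₁) + (Y₁ + E X₁) := by abel
    rw [e]
    refine (hinner.mono ?_).add (hY₁.add hEX₁)
    calc ρ * γ ≤ 1 * γ := mul_le_mul' hρ.le le_rfl
      _ = γ := one_mul γ
  -- outer increment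
  have houter : ValBound (ρ * γ) (S (Tinv * X * T + Tinv * X₁ * T) (S Y (E X) + (S (Y + Y₁) (E X + E X₁) - S Y (E X)))
      - S (Tinv * X * T) (S Y (E X)) - Tinv * X₁ * T - (S (Y + Y₁) (E X + E X₁) - S Y (E X))) := by
    simpa only [max_self] using hincr hW hZ hD hE' hγ hγ
  -- assemble
  have eW : Tinv * (X + X₁) * T = Tinv * X * T + Tinv * X₁ * T := by rw [Matrix.mul_add, Matrix.add_mul]
  have eZ : S Y (E X) + (S (Y + Y₁) (E X + E X₁) - S Y (E X)) = S (Y + Y₁) (E X + E X₁) := by abel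
  rw [eW, map_add E X X₁, ← eZ]
  have e : S (Tinv * X * T + Tinv * X₁ * T) (S Y (E X) + (S (Y + Y₁) (E X + E X₁) - S Y (E X))) - S (Tinv * X * T) (S Y (E X))
        - (Tinv * X₁ * T + E X₁ + Y₁)
      = (S (Tinv * X * T + Tinv * X₁ * T) (S Y (E X) + (S (Y + Y₁) (E X + E X₁) - S Y (E X)))
          - S (Tinv * X * T) (S Y (E X)) - Tinv * X₁ * T - (S (Y + Y₁) (E X + E X₁) - S Y (E X)))
        + (S (Y + Y₁) (E X + E X₁) - S Y (E X) - Y₁ - E X₁) := by abel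
  rw [e]
  exact houter.add hinner

/-- **THE FILTERED NEWTON ESTIMATE FOR THE TUBE MAP WITH AN ADDITIVE THIRD SLOT** (Cayley-sandwich instance): with `Θ(X, Y) = S(T⁻¹XT, S(Y, E X))`,
`S(W, Z) = (1 − W)⁻¹(W + Z)(1 + WZ)⁻¹(1 − W)`, and `L(X₁, Y₁) = T⁻¹X₁T + E X₁ + Y₁`: `Θ(X + X₁, Y + Y₁) − Θ(X, Y) − L(X₁, Y₁) ≤ ργ` for `T, T⁻¹` integral,
`X, Y, E X ≤ ρ < 1`, `X₁, Y₁, E X₁ ≤ γ ≤ ρ`. [cite: Serre1992LALG, Part II Ch. IV §8] [cite: Rogawski1990, §12.5] -/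
theorem valBound_twistedSandwich_incr_slot {ρ γ : ValueGroupWithZero F} (hρ : ρ < 1) (hγ : γ ≤ ρ) (E : Matrix m m F →+ Matrix m m F)
    {T Tinv X Y X₁ Y₁ : Matrix m m F} (hT1 : ValBound 1 T) (hTinv1 : ValBound 1 Tinv) (hX : ValBound ρ X) (hY : ValBound ρ Y)
    (hX₁ : ValBound γ X₁) (hY₁ : ValBound γ Y₁) (hEX : ValBound ρ (E X)) (hEX₁ : ValBound γ (E X₁)) :
    ValBound (ρ * γ)
      ((fun W Z : Matrix m m F => (1 - W)⁻¹ * (W + Z) * (1 + W * Z)⁻¹ * (1 - W)) (Tinv * (X + X₁) * T)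
          ((fun W Z : Matrix m m F => (1 - W)⁻¹ * (W + Z) * (1 + W * Z)⁻¹ * (1 - W)) (Y + Y₁) (E (X + X₁)))
        - (fun W Z : Matrix m m F => (1 - W)⁻¹ * (W + Z) * (1 + W * Z)⁻¹ * (1 - W)) (Tinv * X * T)
          ((fun W Z : Matrix m m F => (1 - W)⁻¹ * (W + Z) * (1 + W * Z)⁻¹ * (1 - W)) Y (E X))
        - (Tinv * X₁ * T + E X₁ + Y₁)) :=
  valBound_twisted_incr_of_sandwich_slot (fun W Z : Matrix m m F => (1 - W)⁻¹ * (W + Z) * (1 + W * Z)⁻¹ * (1 - W)) hρ hγ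
    (fun hW hX => by simpa only [max_self] using valBound_cayleySandwich hW hX hρ hρ)
    (fun hW hX hD hE hδ hε => valBound_cayleySandwich_incr_both hW hX hD hE hρ hδ hε) E hT1 hTinv1 hX hY hX₁ hY₁ hEX hEX₁

end Summit.HodgeConjecture.HodgeConjecture.R90.S4
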